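import Literature.MathematicalPhysics.QuantumFieldTheory.Balaban1983to89.T3AlphaInputsACSchemas
import HarnessLib

/-!
# `Balaban1983to89.T3AlphaInputsACSmallFactorC` — the (α) socket's small-factor schema (70)–(71) WITH THE CONSTANT AND THE REGION AS PARAMETERS
# (`SmallFactor71C`), and the multiplicity schema of the regions (`RegionMultiplicity`) — route owner RULING g20-№4 (B) of `UnitScaleTilt`, 2026-08-27,
# after lane finding F-α1-12

WHY.  `T3AlphaInputsACSchemas.SmallFactor71` fixes the constant `¼` and the region `plaqsIn 0 (blockAround K i p′)`.  [Balaban1985UV3] (71) p.273 «the part of the action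
(1/g_k²)A^η(U_k) localized to … Δ′ … can be bounded from below by ¼p²(g_j)» is printed for the action with the UN-normalised trace; the tree's `reTr` is the normalised
trace `Re Tr/N` (`Balaban1985CMP102.Setting`, F11), so in the tree's units the printed constant is `1/(4N)` (`⅛` for SU(2)) — the lane `pub-balaban3d` proves exactly that
(`Run3SmallFactors.smallFactorsAdm_tower3`, booked `c₁ = 1/(4N)`), over the region of fine plaquettes of `p′`'s orientation whose base point lies in the four blocks of `Δ′`
(the Stokes step reads the boundary layer), which is incomparable with `plaqsIn 0 (blockAround …)`.  This file re-types the clause with BOTH as parameters and adds the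
bookkeeping schema the consumer (crux 19936's 4c) needs in place of disjointness: a uniform bound on how many regions of recorded plaquettes contain a given fine
plaquette.  Hypothesis schemas on exposed data, never asserted; §2 are small proved facts (monotonicity, the old clause as an instance, the summed bound).

* §1 `SmallFactor71C D W b₀ p₀ c Δ` — «for an admissible pair and every large-field plaquette `p′ ∈ P_i` of the history:
  `c·p(g_i)² ≤ β_K·Σ_{q ∈ Δ K i p′} [1 − Re tr U_j(h,W)(∂q)]`»; `RegionMultiplicity W Δ m` — «every fine plaquette lies in at most `m` of the regions `Δ K i p′`,
  `p′ ∈ P_i(r)`, `i < j`, of one region history».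
* §2 `SmallFactor71C.mono` (smaller constant), `smallFactor71C_of_smallFactor71` (the fixed clause = the instance `c = ¼`, `Δ = plaqsIn 0 ∘ blockAround`),
  `SmallFactor71C.sum_le_mainT` (with `RegionMultiplicity … m` and `MainTermIsAction`: `Σ_{i<j} #P_i(r)·c·p(g_i)² ≤ m·mainT_j(h, W)`).

References: T. Bałaban, Commun. Math. Phys. 102 (1985) 255–275 [Balaban1985UV3] ((5) p.256, (67)–(71) pp.273–274).
-/

noncomputable section

open MeasureTheory
open scoped BigOperators
open Literature.MathematicalPhysics.QuantumFieldTheory.Balaban1983to89.T3ContinuumYM3Torus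
open Literature.MathematicalPhysics.QuantumFieldTheory.Balaban1983to89.T3UnitLawDensityEML (ℰp)
open Literature.MathematicalPhysics.QuantumFieldTheory.Balaban1983to89.T3UnitScaleTilt
open Literature.MathematicalPhysics.QuantumFieldTheory.Balaban1983to89.T3AlphaInputsAC
open Literature.MathematicalPhysics.QuantumFieldTheory.Balaban1983to89.T3AlphaInputsACSchemas
open Literature.MathematicalPhysics.QuantumFieldTheory.Balaban1983to89.B10Eq38TorusDomains (plaqsIn)

namespace Literature.MathematicalPhysics.QuantumFieldTheory.Balaban1983to89.T3AlphaInputsACSmallFactorC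

variable {F : T3Family} {γ : ℝ}

/-! ## §1 The schemas -/

/-- **THE SMALL FACTORS (70)–(71) WITH CONSTANT `c` OVER THE REGION FAMILY `Δ`** (hypothesis schema, never asserted): for an admissible pair `(h, W)` of run `K`,
level `j ≤ K`, and every large-field plaquette `p′ ∈ P_i` of the history, the part of the main action localised to the finite set `Δ K i p′` of fine plaquettes is at
least `c·p(g_i)²` in units of `β_K`: `c·p(g_i)² ≤ β_K·Σ_{q ∈ Δ K i p′} [1 − Re tr U_j(h,W)(∂q)]`, `g_i = √(γL^{−(K−i)})` — [Balaban1985UV3] (70)–(71) p.273 «the part of the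
action (1/g_k²)A^η(U_k) localized to the sum of four j-blocks Δ′ connected with the plaquette p′ can be bounded from below by ¼p²(g_j)»; printed `¼` is for the un-normalised
trace, i.e. `c = 1/(4N)` with the tree's normalised `reTr` (`T3AlphaInputsACSchemas.SmallFactor71` is the instance `c = ¼`, `Δ = plaqsIn 0 ∘ blockAround`).
[cite: Balaban1985UV3, (70)-(71) p.273] -/
def SmallFactor71C (D : AlphaDataT3 F γ) (W : LFData D) (b₀ p₀ c : ℝ) (Δ : (K i : ℕ) → Plaq (F.P K) i → Finset (Plaq (F.P K) 0)) : Prop :=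
  ∀ K j (r : W.Reg K j) v Wf, j ≤ K → D.Adm K j (W.assemble K j r v) Wf → ∀ i (p' : Plaq (F.P K) i), p' ∈ W.LargeP K j r i →
    c * B10.pFun b₀ p₀ (Real.sqrt (γ * ((F.L : ℝ)⁻¹) ^ (K - i))) ^ 2 ≤
      (F.scheme ℰp γ).β K * ∑ q ∈ Δ K i p', (1 - reTr (GaugeField.plaqHol (D.Umin K j (W.assemble K j r v) Wf) q))

open scoped Classical in
/-- **MULTIPLICITY OF THE REGIONS** (hypothesis schema, never asserted; the bookkeeping [Balaban1985UV3] leaves to [9] §3.C, p.273 L31–33): for every region history `r` of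
level `j ≤ K` whose assembled pair is admissible and every fine plaquette `q`, at most `m` of the regions `Δ K i p′` of its recorded plaquettes `p′ ∈ P_i(r)`, `i < j`, contain `q`
(print's `Δ′` are disjoint for an admissible history up to the four plaquettes sharing a block corner: the lane proves `m = 4`). [cite: Balaban1985UV3, (69)-(71) p.273] -/
def RegionMultiplicity (D : AlphaDataT3 F γ) (W : LFData D) (Δ : (K i : ℕ) → Plaq (F.P K) i → Finset (Plaq (F.P K) 0)) (m : ℕ) : Prop :=
  ∀ K j (r : W.Reg K j) v Wf, j ≤ K → D.Adm K j (W.assemble K j r v) Wf → ∀ q : Plaq (F.P K) 0,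
    ∑ i ∈ Finset.range j, ((W.LargeP K j r i).filter fun p' => q ∈ Δ K i p').card ≤ m

/-! ## §2 Small facts -/

variable {D : AlphaDataT3 F γ} {W : LFData D} {b₀ p₀ : ℝ}

/-- Any smaller constant: `c′ ≤ c` ⇒ `SmallFactor71C … c Δ → SmallFactor71C … c′ Δ` (monotonicity of the printed clause in its constant). [cite: Balaban1985UV3, (70)-(71) p.273] -/
theorem SmallFactor71C.mono {c c' : ℝ} {Δ : (K i : ℕ) → Plaq (F.P K) i → Finset (Plaq (F.P K) 0)} (h : SmallFactor71C D W b₀ p₀ c Δ) (hc : c' ≤ c) :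
    SmallFactor71C D W b₀ p₀ c' Δ :=
  fun K j r v Wf hj hadm i p' hp => (mul_le_mul_of_nonneg_right hc (sq_nonneg _)).trans (h K j r v Wf hj hadm i p' hp)

/-- The fixed clause `SmallFactor71` IS the instance `c = ¼`, `Δ K i p′ = plaqsIn 0 (blockAround K i p′)`. [cite: Balaban1985UV3, (70)-(71) p.273] -/
theorem smallFactor71C_of_smallFactor71 (h : SmallFactor71 D W b₀ p₀) :
    SmallFactor71C D W b₀ p₀ (1 / 4) (fun K i p' => plaqsIn 0 (blockAround K i p')) :=
  fun K j r v Wf hj hadm i p' hp => h K j r v Wf hj hadm i p' hp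

/-- **THE SUMMED SMALL FACTORS** (the use 4c makes of the clause): under `SmallFactor71C … c Δ`, `RegionMultiplicity … Δ m` and `MainTermIsAction`, for an admissible pair
`Σ_{i<j} #P_i(r)·c·p(g_i)² ≤ m·mainT_j(h, W)` — every region's share of the action is counted at most `m` times and the plaquette terms are non-negative.
[cite: Balaban1985UV3, (70)-(71) p.273 and p.273 L31-33] -/
theorem SmallFactor71C.sum_le_mainT {c : ℝ} {Δ : (K i : ℕ) → Plaq (F.P K) i → Finset (Plaq (F.P K) 0)} {m : ℕ} (h : SmallFactor71C D W b₀ p₀ c Δ)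
    (hm : RegionMultiplicity D W Δ m) (hM : MainTermIsAction D) (hβ : ∀ K, 0 ≤ (F.scheme ℰp γ).β K)
    (K j : ℕ) (r : W.Reg K j) (v : (i : Fin j) → GaugeField (F.P K) i (Matrix.specialUnitaryGroup (Fin 2) ℂ))
    (Wf : GaugeField (F.P K) j (Matrix.specialUnitaryGroup (Fin 2) ℂ)) (hj : j ≤ K) (hadm : D.Adm K j (W.assemble K j r v) Wf) :
    ∑ i ∈ Finset.range j, ((W.LargeP K j r i).card : ℝ) * (c * B10.pFun b₀ p₀ (Real.sqrt (γ * ((F.L : ℝ)⁻¹) ^ (K - i))) ^ 2) ≤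
      (m : ℝ) * D.mainT K j (W.assemble K j r v) Wf := by
  classical
  set U := D.Umin K j (W.assemble K j r v) Wf with hU
  set t : Plaq (F.P K) 0 → ℝ := fun q => (F.scheme ℰp γ).β K * (1 - reTr (GaugeField.plaqHol U q)) with ht
  have ht0 : ∀ q, 0 ≤ t q := fun q =>
    mul_nonneg (hβ K) (by have := GaugeGroup.reTr_le_one (GaugeField.plaqHol U q); linarith)
  -- per region
  have hreg : ∀ i ∈ Finset.range j, ((W.LargeP K j r i).card : ℝ) * (c * B10.pFun b₀ p₀ (Real.sqrt (γ * ((F.L : ℝ)⁻¹) ^ (K - i))) ^ 2) ≤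
      ∑ p' ∈ W.LargeP K j r i, ∑ q ∈ Δ K i p', t q := by
    intro i _
    rw [← nsmul_eq_mul, ← Finset.sum_const]
    refine Finset.sum_le_sum fun p' hp => ?_
    rw [ht, ← Finset.mul_sum]
    exact h K j r v Wf hj hadm i p' hp
  -- per region and fine plaquette: the share of `q` counted with multiplicity
  have key : ∀ i ∈ Finset.range j, ∑ p' ∈ W.LargeP K j r i, ∑ q ∈ Δ K i p', t q
      = ∑ q, (((W.LargeP K j r i).filter fun p' => q ∈ Δ K i p').card : ℝ) * t q := by
    intro i _
    have h1 : ∀ p' ∈ W.LargeP K j r i, ∑ q ∈ Δ K i p', t q = ∑ q, (if q ∈ Δ K i p' then t q else 0) := fun p' _ => by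
      rw [Finset.sum_ite_mem, Finset.univ_inter]
    rw [Finset.sum_congr rfl h1, Finset.sum_comm]
    refine Finset.sum_congr rfl fun q _ => ?_
    rw [← Finset.sum_filter, Finset.sum_const, nsmul_eq_mul]
  have hA : D.mainT K j (W.assemble K j r v) Wf = ∑ q, t q := by
    rw [hM K j _ Wf, ← hU, ht, ← Finset.mul_sum]
    unfold wilsonAction4 wilsonAction
    simp only [one_mul]
  calc ∑ i ∈ Finset.range j, ((W.LargeP K j r i).card : ℝ) * (c * B10.pFun b₀ p₀ (Real.sqrt (γ * ((F.L : ℝ)⁻¹) ^ (K - i))) ^ 2)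
      ≤ ∑ i ∈ Finset.range j, ∑ p' ∈ W.LargeP K j r i, ∑ q ∈ Δ K i p', t q := Finset.sum_le_sum hreg
    _ = ∑ i ∈ Finset.range j, ∑ q, (((W.LargeP K j r i).filter fun p' => q ∈ Δ K i p').card : ℝ) * t q := Finset.sum_congr rfl key
    _ = ∑ q, (∑ i ∈ Finset.range j, (((W.LargeP K j r i).filter fun p' => q ∈ Δ K i p').card : ℝ)) * t q := by
        rw [Finset.sum_comm]
        refine Finset.sum_congr rfl fun q _ => ?_
        rw [Finset.sum_mul]
    _ ≤ ∑ q, (m : ℝ) * t q := Finset.sum_le_sum fun q _ => mul_le_mul_of_nonneg_right (by exact_mod_cast hm K j r v Wf hj hadm q) (ht0 q)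
    _ = (m : ℝ) * D.mainT K j (W.assemble K j r v) Wf := by rw [hA, Finset.mul_sum]

end Literature.MathematicalPhysics.QuantumFieldTheory.Balaban1983to89.T3AlphaInputsACSmallFactorC

end
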